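import Literature.Computability.Complexity.RossmanMonotoneCliqueApprox
import Literature.Computability.Complexity.NegationElimination

/-!
# The ⋆-closed approximation of a monotone program, structural form (Rossman 2010, §5.2)

Route `OneSlice`, crux `Summit.PneNP.PneNP.Theses.OneSlice.SingleThreshold` (stmt-PneNP-2833), line
`two-round-exposure`: the registered stub `stub_structuralApprox` (shared verbatim with the line
`self-noise-closure`).

Rossman (FOCS 2010, §5.2 with Lemmas 13–14, p. 8) approximates every wire of a straight-line
program over `{∧₂, ∨₂}` by a monotone ⋆-closed function: input wires by themselves, an `∧`-gate by
the exact conjunction of the approximators of its two children, an `∨`-gate by the ⋆-closure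
(w.r.t. `(p, t, K = I ∪ J)`) of the disjunction of the approximators of its children. The tree's
`Literature.Computability.Complexity.exists_closedApprox` performs exactly this construction along
`List.reverseRecOn` (`StarApproxInv.nil` / `StarApproxInv.snoc`) but only exports the invariant
`StarApproxInv` (monotone, ⋆-closed, dominating, Lemma 13 error bound, Lemma 14 minterm locality).
Here the same induction is redone with the CONSTRUCTION recorded in the conclusion as three
structural clauses:

* `ap (inl i) = fun x => x i`;
* `gs[m]? = some (andGate u v) → ap (inr m) = fun x => ap u x && ap v x`;
* `gs[m]? = some (orGate u v) → ap (inr m) = starClosure p t (I ∪ J) (fun x => ap u x || ap v x)`.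

The induction step (`clauses_snoc`) only uses that appending a gate does not move earlier gates
(`List.getElem?_append_left`), that the children of a gate at position `m` of a well-formed program
are wires valid below `m` (`GateList.WF`), and that a gate over `monotoneBasis` is an `andGate` or an
`orGate` (`exists_eq_andGate_of_fn_eq` / `exists_eq_orGate_of_fn_eq`), these two shapes being
injective in their wires and distinct.

## References

* B. Rossman, *The monotone complexity of k-clique on random graphs*, FOCS 2010 (full version
  2009), §5.2, Lemmas 13 and 14, p. 8 [Rossman2010].
-/

noncomputable section

open Finset

open scoped Classical

set_option linter.dupNamespace false

namespace Summit.PneNP.PneNP.Theorems.SingleThreshold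

open Literature.Computability.Complexity GateList

variable {ι : Type*}

/-- `andGate` is injective in its two wires. [folklore] -/
theorem andGate_inj {u v u' v' : ι ⊕ ℕ} (h : andGate u v = andGate u' v') : u = u' ∧ v = v' := by
  simp only [andGate, Gate.mk.injEq, heq_eq_eq, true_and, Matrix.vecCons_inj, and_true] at h
  exact h

/-- `orGate` is injective in its two wires. [folklore] -/
theorem orGate_inj {u v u' v' : ι ⊕ ℕ} (h : orGate u v = orGate u' v') : u = u' ∧ v = v' := by
  simp only [orGate, Gate.mk.injEq, heq_eq_eq, true_and, Matrix.vecCons_inj, and_true] at h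
  exact h

/-- A conjunction gate is not a disjunction gate: their truth tables differ at `(1, 0)`.
[folklore] -/
theorem andGate_ne_orGate {u v u' v' : ι ⊕ ℕ} : andGate u v ≠ orGate u' v' := by
  intro h
  have h1 : GateFn.and 2 = GateFn.or 2 := by
    rw [← andGate_fn u v, ← orGate_fn u' v', h]
  have h2 := (Sigma.mk.inj_iff.1 h1).2
  have h3 := congrFun (eq_of_heq h2) (fun i : Fin 2 => decide (i = 0))
  revert h3
  decide

variable [Fintype ι] [DecidableEq ι] {p t : ℝ} {I J : Finset (ι → Bool)}

/-- **The induction step for the structural clauses.** If `ap` satisfies the `∧`/`∨`-clauses for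
the well-formed program `gs`, the gate `g` only reads wires valid below `gs.length`, and `ap'`
agrees with `ap` off the new wire `inr gs.length`, where it is the conjunction (if `g` is an
`andGate`) resp. the ⋆-closed disjunction (if `g` is an `orGate`) of the approximators of the
children of `g`, then `ap'` satisfies the clauses for `gs ++ [g]`; the invariant `StarApproxInv`
(whose first field is the input clause) is passed through. [cite: Rossman2010, §5.2 (p. 8)] -/
theorem clauses_snoc {gs : List (Gate ι)} (hwf : WF gs) {g : Gate ι} (hgOK : GateOK gs.length g)
    {ap ap' : ι ⊕ ℕ → (ι → Bool) → Bool} (hstar : StarApproxInv p t I J (gs ++ [g]) ap')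
    (hand : ∀ (m : ℕ) (u v : ι ⊕ ℕ), gs[m]? = some (andGate u v) →
      ap (Sum.inr m) = fun x => ap u x && ap v x)
    (hor : ∀ (m : ℕ) (u v : ι ⊕ ℕ), gs[m]? = some (orGate u v) →
      ap (Sum.inr m) = starClosure p t (I ∪ J) (fun x => ap u x || ap v x))
    (hold : ∀ w, w ≠ Sum.inr gs.length → ap' w = ap w)
    (hnew_and : ∀ u v, g = andGate u v → ap' (Sum.inr gs.length) = fun x => ap u x && ap v x)
    (hnew_or : ∀ u v, g = orGate u v →
      ap' (Sum.inr gs.length) = starClosure p t (I ∪ J) (fun x => ap u x || ap v x)) :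
    (∀ i, ap' (Sum.inl i) = fun x => x i) ∧
    (∀ (m : ℕ) (u v : ι ⊕ ℕ), (gs ++ [g])[m]? = some (andGate u v) →
      ap' (Sum.inr m) = fun x => ap' u x && ap' v x) ∧
    (∀ (m : ℕ) (u v : ι ⊕ ℕ), (gs ++ [g])[m]? = some (orGate u v) →
      ap' (Sum.inr m) = starClosure p t (I ∪ J) (fun x => ap' u x || ap' v x)) ∧
    StarApproxInv p t I J (gs ++ [g]) ap' := by
  have hlast : (gs ++ [g])[gs.length]? = some g := List.getElem?_concat_length
  -- wires valid below `gs.length` keep their approximator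
  have hold' : ∀ w, OutOK gs.length w → ap' w = ap w := fun w hw =>
    hold w fun h => lt_irrefl gs.length (hw gs.length h)
  -- an old gate position is valid below `gs.length`
  have hpos : ∀ {m : ℕ}, m < gs.length → OutOK gs.length (Sum.inr m : ι ⊕ ℕ) := by
    intro m hm n hn
    cases hn
    exact hm
  -- beyond the new gate there is nothing
  have hnone : ∀ {m : ℕ}, gs.length < m → (gs ++ [g])[m]? = none := fun hm =>
    List.getElem?_eq_none (by rw [List.length_append, List.length_singleton]; omega)
  refine ⟨hstar.inl, fun m u v hm => ?_, fun m u v hm => ?_, hstar⟩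
  · rcases lt_trichotomy m gs.length with hlt | rfl | hgt
    · rw [List.getElem?_append_left hlt] at hm
      have hok : GateOK m (andGate u v) := hwf m _ hm
      have hu : OutOK gs.length u := fun n hn => (hok (0 : Fin 2) n hn).trans hlt
      have hv : OutOK gs.length v := fun n hn => (hok (1 : Fin 2) n hn).trans hlt
      rw [hold' _ (hpos hlt), hold' u hu, hold' v hv]
      exact hand m u v hm
    · rw [hlast, Option.some.injEq] at hm
      subst hm
      have hu : OutOK gs.length u := fun n hn => hgOK (0 : Fin 2) n hn
      have hv : OutOK gs.length v := fun n hn => hgOK (1 : Fin 2) n hn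
      rw [hnew_and u v rfl, hold' u hu, hold' v hv]
    · rw [hnone hgt] at hm
      cases hm
  · rcases lt_trichotomy m gs.length with hlt | rfl | hgt
    · rw [List.getElem?_append_left hlt] at hm
      have hok : GateOK m (orGate u v) := hwf m _ hm
      have hu : OutOK gs.length u := fun n hn => (hok (0 : Fin 2) n hn).trans hlt
      have hv : OutOK gs.length v := fun n hn => (hok (1 : Fin 2) n hn).trans hlt
      rw [hold' _ (hpos hlt), hold' u hu, hold' v hv]
      exact hor m u v hm
    · rw [hlast, Option.some.injEq] at hm
      subst hm
      have hu : OutOK gs.length u := fun n hn => hgOK (0 : Fin 2) n hn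
      have hv : OutOK gs.length v := fun n hn => hgOK (1 : Fin 2) n hn
      rw [hnew_or u v rfl, hold' u hu, hold' v hv]
    · rw [hnone hgt] at hm
      cases hm

/-- **The ⋆-closed approximation of a monotone program, with its construction** (Rossman 2010,
§5.2 with Lemmas 13 and 14): for a bias `0 ≤ p ≤ 1`, a trigger `0 ≤ t < 1 − p` and classes `I, J`
of vectors with all single-coordinate vectors in `I` and `I ⊔ I ⊆ I ∪ J`, every well-formed
`{∧₂, ∨₂}`-program `gs` has wire approximators `ap` which are (a) exact on input wires, (b) the
exact conjunction of the approximators of the children at every `∧`-gate, (c) the ⋆-closure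
(w.r.t. `(p, t, I ∪ J)`) of the disjunction of the approximators of the children at every
`∨`-gate, and (d) satisfy `StarApproxInv` (monotone, ⋆-closed, dominating, Lemma 13 error bound
`≤ #gates · |I ∪ J| · t`, Lemma 14 minterm locality). This is the structural form of the tree's
`exists_closedApprox`, proved by the same induction (`StarApproxInv.nil` / `StarApproxInv.snoc`)
with the construction exported (`clauses_snoc`). [cite: Rossman2010, §5.2, Lemmas 13–14 (p. 8)] -/
theorem stub_structuralApprox {ι : Type*} [Fintype ι] [DecidableEq ι] {p t : ℝ}
    (hp0 : 0 ≤ p) (hp1 : p ≤ 1) (ht : 0 ≤ t) (htp : t < 1 - p)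
    {I J : Finset (ι → Bool)} (hI1 : ∀ i, indVec {i} ∈ I)
    (hIJ : ∀ x ∈ I, ∀ y ∈ I, x ⊔ y ∈ I ∪ J)
    (gs : List (Gate ι)) (hwf : GateList.WF gs) (hB : ∀ g ∈ gs, g.fn ∈ monotoneBasis) :
    ∃ ap : ι ⊕ ℕ → (ι → Bool) → Bool,
      (∀ i, ap (Sum.inl i) = fun x => x i) ∧
      (∀ (m : ℕ) (u v : ι ⊕ ℕ), gs[m]? = some (GateList.andGate u v) →
          ap (Sum.inr m) = fun x => ap u x && ap v x) ∧
      (∀ (m : ℕ) (u v : ι ⊕ ℕ), gs[m]? = some (GateList.orGate u v) →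
          ap (Sum.inr m) = starClosure p t (I ∪ J) (fun x => ap u x || ap v x)) ∧
      StarApproxInv p t I J gs ap := by
  induction gs using List.reverseRecOn with
  | nil =>
    refine ⟨_, ?_, ?_, ?_, StarApproxInv.nil htp hI1⟩
    · intro i
      rfl
    · intro m u v hm
      simp at hm
    · intro m u v hm
      simp at hm
  | append_singleton gs g ih =>
    obtain ⟨ap, -, hand, hor, hap⟩ :=
      ih hwf.of_append_left fun g' hg' => hB g' (List.mem_append_left _ hg')
    have hgOK : GateOK gs.length g := hwf.gateOK_mid (post := [])
    have hgB : g.fn ∈ monotoneBasis := hB g (by simp)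
    have hnew : ∀ x, (vals (gs ++ [g]) x).getD gs.length false =
        g.op (fun a => wireOf x (vals gs x) (g.args a)) := fun x =>
      getD_vals_append_cons gs g [] x
    simp only [monotoneBasis, Set.mem_insert_iff, Set.mem_singleton_iff] at hgB
    rcases hgB with hc | hc
    · -- AND gate: exact conjunction of the approximators of the children
      obtain ⟨u, v, rfl⟩ := exists_eq_andGate_of_fn_eq hc
      have hu : OutOK gs.length u := fun n hn => hgOK (0 : Fin 2) n hn
      have hv : OutOK gs.length v := fun n hn => hgOK (1 : Fin 2) n hn
      have hap' := hap.snoc hp0 hp1 (andGate u v) u v hu hv (fun a b => a && b)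
        (fun x => by rw [hnew, andGate_op]) (fun x => ap u x && ap v x)
        (monotone_band (hap.mono u hu) (hap.mono v hv))
        ((hap.closed u hu).band hp0 hp1 (hap.closed v hv)) (fun x hx => hx)
        (fun a b a' b' h1 h2 => by
          rw [Bool.le_iff_imp] at h1 h2 ⊢; simp only [Bool.and_eq_true]; tauto)
        ((le_of_eq ((prob_congr fun x => by simp).trans (prob_false p))).trans
          (mul_nonneg (Nat.cast_nonneg _) ht))
        (fun H₀ hU hV H hH hle => by
          obtain ⟨m₁, m₂, hm₁, hm₂, h1, h2, rfl⟩ := hH.of_and (hap.mono u hu) (hap.mono v hv)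
          exact hIJ _ (hU m₁ hm₁ (h1.trans hle)) _ (hV m₂ hm₂ (h2.trans hle)))
      refine ⟨_, clauses_snoc hwf.of_append_left hgOK hap' hand hor (fun w hw => if_neg hw)
        (fun u' v' huv => ?_) (fun u' v' huv => (andGate_ne_orGate huv).elim)⟩
      obtain ⟨rfl, rfl⟩ := andGate_inj huv
      exact if_pos rfl
    · -- OR gate: ⋆-closure of the disjunction of the approximators of the children
      obtain ⟨u, v, rfl⟩ := exists_eq_orGate_of_fn_eq hc
      have hu : OutOK gs.length u := fun n hn => hgOK (0 : Fin 2) n hn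
      have hv : OutOK gs.length v := fun n hn => hgOK (1 : Fin 2) n hn
      have hmuv : Monotone fun x => ap u x || ap v x := monotone_bor (hap.mono u hu) (hap.mono v hv)
      have hap' := hap.snoc hp0 hp1 (orGate u v) u v hu hv (fun a b => a || b)
        (fun x => by rw [hnew, orGate_op]) (starClosure p t (I ∪ J) fun x => ap u x || ap v x)
        (monotone_starClosure p t _ hmuv) (isClosedFn_starClosure p t _ hmuv)
        (fun x hx => by
          have := le_starClosure p t (I ∪ J) (fun x => ap u x || ap v x) x
          rw [Bool.le_iff_imp] at this
          exact this hx)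
        (fun a b a' b' h1 h2 => by
          rw [Bool.le_iff_imp] at h1 h2 ⊢; simp only [Bool.or_eq_true]; tauto)
        (prob_ne_starClosure_le hp0 hp1 ht _ hmuv)
        (fun H₀ hU hV H hH hle => by
          rcases hH.of_starClosure with hH | hH
          · rcases hH.of_or with hH | hH
            · exact mem_union_left _ (hU H hH hle)
            · exact mem_union_left _ (hV H hH hle)
          · exact hH)
      refine ⟨_, clauses_snoc hwf.of_append_left hgOK hap' hand hor (fun w hw => if_neg hw)
        (fun u' v' huv => (andGate_ne_orGate huv.symm).elim) (fun u' v' huv => ?_)⟩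
      obtain ⟨rfl, rfl⟩ := orGate_inj huv
      exact if_pos rfl

end Summit.PneNP.PneNP.Theorems.SingleThreshold
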